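import Literature.Geometry.Kaehler.HolomorphicChainFacts
import Mathlib.RingTheory.Norm.Transitivity
import Mathlib.RingTheory.Complex
import HarnessLib

/-!
# Holomorphic chains as currents: proved bricks (canonical orientation; blow-ups off the support)

Proved lemmas for the objects of `HolomorphicChain.lean` / `HolomorphicChainFacts.lean`, in
particular towards the named fact `Literature.Geometry.Kaehler.King1971_tangentCone` (King's
tangent cone theorem [Harvey1977, Thm. 1.31]; general proof [Federer1969, 4.3.18–4.3.19]). No
definitions, no named facts.

## The canonical complex orientation

* `complexFrame_apply`, `span_complexFrame` — slot formula for the real `2p`-frame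
  `complexFrame u = (u₀, I u₀, u₁, I u₁, …)` of a complex `p`-frame `u`, and
  `span_ℝ (complexFrame u) = span_ℂ (u)`;
* `frameVector_complexFrame_eq_of_span_eq` — **the `2p`-vector of a unitary frame depends only on
  the complex `p`-plane it spans**: for unitary `u, u'` with the same span,
  `φ(complexFrame u') = φ(complexFrame u)` for every real alternating `2p`-form `φ`. Proof: inside
  the plane `P`, `complexFrame u' = g_ℝ ∘ complexFrame u` for the unitary `g` with `g uⱼ = u'ⱼ`, so
  the two values differ by `det_ℝ g_ℝ = N_{ℂ/ℝ}(det_ℂ g) = |det_ℂ g|² = 1`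
  (`LinearMap.det_restrictScalars`, `OrthonormalBasis.det_to_matrix_orthonormalBasis`): a complex
  subspace is canonically oriented [Griffiths–Harris, Ch. 0 §2];
* `HolomorphicChain.frameVector_orientationFrame` — hence the frame field `ξ_T` chosen (by
  `Classical.choice`) in `HolomorphicChain.orientationFrame` may be replaced, inside
  `[T](φ) = ∫ θ_T φ(ξ_T) d𝓗^{2p}`, by ANY field of unitary frames of the approximate tangent planes;
  `HolomorphicChain.orientationFrame_eq_zero` — the frame is `0` where the approximate tangent
  cone is not a complex `p`-plane.

## The blow-ups `(1/r)_*(τ_{-b})_*[T]` off the support, and two easy cases of King's theorem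

* `HolomorphicChain.blowUp_eq_zero_of_disjoint` — if `B(b,r)` misses `|T|` then
  `(1/r)_*(τ_{-b})_*[T] = 0` on `B(0,1)` (empty carrier);
* `HolomorphicChain.exists_ball_disjoint_support`, `HolomorphicChain.eventually_blowUp_eq_zero` —
  off the (relatively closed) support the blow-ups vanish for all small `r > 0`;
* `King1971_tangentCone_of_notMem_support` — the conclusion of `King1971_tangentCone` at every
  base point `b ∈ Ω ∖ |T|`, with tangent cone `C(T, b) = 0` (`0` lies in every basic
  neighbourhood of Federer's `𝓕^{loc}` topology [Federer1969, 4.3.16], `R = S = 0`);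
  `King1971_tangentCone_of_finrank_lt` — the case `p > dim_ℂ V`, where every holomorphic
  `p`-chain is `0`.

The substantial case `b ∈ |T|` of King's theorem (existence and uniqueness of the tangent cone:
Federer's slicing argument in the deformation space `ℝ × ℝⁿ`, 4.3.18, resting on the local
finiteness of the Hausdorff measure of real-analytic varieties, 3.4.8) is NOT here.

## References

* R. Harvey, *Holomorphic chains and their boundaries*, PSPUM XXX.1 (1977), §1.10, Thm. 1.31
  [Harvey1977] (held: `lit galaxy panama:376316444541009`, p. 298 of the scan).
* H. Federer, *Geometric Measure Theory*, Springer 1969, 4.3.16–4.3.19 [Federer1969].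
* E. M. Chirka, *Complex Analytic Sets*, Kluwer 1989, §14.1 [Chirka1989].
* P. Griffiths, J. Harris, *Principles of Algebraic Geometry*, Ch. 0 §2 (orientation of complex
  manifolds).
-/

open scoped Manifold ContDiff Topology ENNReal Pointwise
open Set Filter MeasureTheory

namespace Literature.Geometry.Kaehler

open Literature.Geometry.GeometricMeasureTheory

-- Nested operator-norm instances on `Covector V m`, as in `Currents.lean`.
set_option maxSynthPendingDepth 2

universe u

/-! ### The canonical complex orientation -/

section Orientation

variable {V : Type*} [NormedAddCommGroup V] [InnerProductSpace ℂ V] {p : ℕ}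

/-- Slot formula for `complexFrame`: slot `k` carries `u_{⌊k/2⌋}` for even `k` and
`I • u_{⌊k/2⌋}` for odd `k`, i.e. `(1 or I) • u_{⌊k/2⌋}`. [folklore] -/
theorem complexFrame_apply (u : Fin p → V) (k : Fin (2 * p)) :
    complexFrame u k =
      (if (k : ℕ) % 2 = 0 then (1 : ℂ) else Complex.I) • u ⟨(k : ℕ) / 2, by omega⟩ := by
  unfold complexFrame
  by_cases h : Even (k : ℕ)
  · simp [h, Nat.even_iff.1 h]
  · simp [h, Nat.odd_iff.1 (Nat.not_even_iff_odd.1 h)]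

/-- **The canonical complex orientation is well defined.** For two unitary `p`-frames `u`, `u'`
spanning the same complex `p`-plane, the real `2p`-frames `complexFrame u = (u₀, I u₀, …)` and
`complexFrame u'` define the same simple `2p`-vector: `φ(complexFrame u') = φ(complexFrame u)` for
every real alternating `2p`-form `φ`. Indeed `complexFrame u' = g_ℝ ∘ complexFrame u` for the
unitary `g` of the plane with `g uⱼ = u'ⱼ`, and `det_ℝ g_ℝ = |det_ℂ g|² = 1`
(`LinearMap.det_restrictScalars`). This is the statement that a complex subspace carries a
canonical orientation. [Griffiths–Harris, Ch. 0 §2] [folklore] -/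
theorem frameVector_complexFrame_eq_of_span_eq {u u' : Fin p → V} (hu : Orthonormal ℂ u)
    (hu' : Orthonormal ℂ u')
    (h : Submodule.span ℂ (Set.range u') = Submodule.span ℂ (Set.range u)) :
    frameVector (complexFrame u') = frameVector (complexFrame u) := by
  rcases Nat.eq_zero_or_pos p with rfl | hp
  · have : complexFrame u' = complexFrame u := funext fun k => absurd k.2 (by omega)
    rw [this]
  haveI : Nonempty (Fin p) := ⟨⟨0, hp⟩⟩
  ext φ
  rw [frameVector_apply, frameVector_apply]
  -- the complex `p`-plane `P` and its unitary basis `bC` given by `u`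
  have hliC : LinearIndependent ℂ u := hu.linearIndependent
  set P : Submodule ℂ V := Submodule.span ℂ (Set.range u) with hP
  let bC : Module.Basis (Fin p) ℂ P := Module.Basis.span hliC
  have hbC : ∀ j, (bC j : V) = u j := fun j => congrArg Subtype.val (Module.Basis.span_apply hliC j)
  have honC : Orthonormal ℂ bC := by
    have e : (fun j => (⟨u j, Submodule.subset_span (Set.mem_range_self j)⟩ : P)) = ⇑bC := by
      funext j
      exact Subtype.ext (hbC j).symm
    rw [← e]
    exact orthonormal_span hu
  -- the second frame, inside `P`
  have hmem : ∀ j, u' j ∈ P := fun j => h ▸ Submodule.subset_span (Set.mem_range_self j)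
  let v' : Fin p → P := Set.codRestrict u' P hmem
  have hv' : Orthonormal ℂ v' := hu'.codRestrict P hmem
  have hcv' : ∀ j, (v' j : V) = u' j := fun j => rfl
  -- the unitary `g` with `g (bC j) = v' j`, `|det g| = 1`
  let g : P →ₗ[ℂ] P := bC.constr ℂ v'
  have hg : ∀ j, g (bC j) = v' j := fun j => Module.Basis.constr_basis bC ℂ v' j
  have hfin : Fintype.card (Fin p) = Module.finrank ℂ P := by
    rw [hP, finrank_span_eq_card hliC]
  have hdet : ‖LinearMap.det g‖ = 1 := by
    let b' : Module.Basis (Fin p) ℂ P := basisOfOrthonormalOfCardEqFinrank hv' hfin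
    have hb' : ⇑b' = v' := coe_basisOfOrthonormalOfCardEqFinrank hv' hfin
    have hv'' : Orthonormal ℂ b' := by rw [hb']; exact hv'
    have h1 : bC.det v' = LinearMap.det g := by
      have e : v' = g ∘ bC := funext fun j => (hg j).symm
      rw [e, Module.Basis.det_comp, Module.Basis.det_self, mul_one]
    have h2 := OrthonormalBasis.det_to_matrix_orthonormalBasis (bC.toOrthonormalBasis honC)
      (b'.toOrthonormalBasis hv'')
    rw [Module.Basis.toBasis_toOrthonormalBasis, Module.Basis.coe_toOrthonormalBasis, hb', h1] at h2
    exact h2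
  -- the real alternating form induced by `φ` on `P`, re-indexed by `Fin 2 × Fin p`
  let f : P [⋀^Fin (2 * p)]→ₗ[ℝ] ℝ := φ.toAlternatingMap.compLinearMap (P.subtype.restrictScalars ℝ)
  have hf : ∀ w : Fin (2 * p) → P, f w = φ (fun k => (w k : V)) := fun w => rfl
  let σ : Fin (2 * p) ≃ Fin 2 × Fin p :=
    (finCongr (Nat.mul_comm 2 p)).trans (finProdFinEquiv.symm.trans (Equiv.prodComm (Fin p) (Fin 2)))
  have hσ1 : ∀ k, ((σ k).1 : ℕ) = (k : ℕ) % 2 := fun k => by simp [σ]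
  have hσ2 : ∀ k, ((σ k).2 : ℕ) = (k : ℕ) / 2 := fun k => by simp [σ]
  let f' : P [⋀^(Fin 2 × Fin p)]→ₗ[ℝ] ℝ := f.domDomCongr σ
  have hf' : ∀ v : Fin 2 × Fin p → P, f' v = f (v ∘ σ) := fun v => rfl
  -- the real basis `(1 • uⱼ, I • uⱼ)` of `P`
  let E : Module.Basis (Fin 2 × Fin p) ℝ P := Complex.basisOneI.smulTower bC
  have hE : ∀ ij, E ij = Complex.basisOneI ij.1 • bC ij.2 := fun ij =>
    Module.Basis.smulTower_apply _ _ ij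
  -- interleaving: `complexFrame w (σ⁻¹ (i, j)) = (basisOneI i) • w j`
  have key : ∀ (w : Fin p → V) (k : Fin (2 * p)),
      complexFrame w k = Complex.basisOneI (σ k).1 • w (σ k).2 := by
    intro w k
    rw [complexFrame_apply]
    have e2 : (⟨(k : ℕ) / 2, by omega⟩ : Fin p) = (σ k).2 := Fin.ext (by rw [hσ2])
    rw [e2]
    congr 1
    rcases Nat.mod_two_eq_zero_or_one k with h0 | h1
    · have e1 : (σ k).1 = 0 := Fin.ext (by rw [hσ1, h0]; rfl)
      rw [e1, Complex.coe_basisOneI]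
      simp [h0]
    · have e1 : (σ k).1 = 1 := Fin.ext (by rw [hσ1, h1]; rfl)
      rw [e1, Complex.coe_basisOneI]
      simp [h1]
  have h1 : φ (complexFrame u) = f' E := by
    rw [hf', hf]
    congr 1
    funext k
    simp only [Function.comp_apply, hE, Submodule.coe_smul, hbC]
    exact key u k
  have h2 : φ (complexFrame u') = f' ((g.restrictScalars ℝ) ∘ E) := by
    rw [hf', hf]
    congr 1
    funext k
    simp only [Function.comp_apply, hE, LinearMap.coe_restrictScalars, map_smul, hg,
      Submodule.coe_smul, hcv']
    exact key u' k
  have h3 : f' ((g.restrictScalars ℝ) ∘ ⇑E) = LinearMap.det (g.restrictScalars ℝ) * f' E := by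
    conv_lhs => rw [AlternatingMap.eq_smul_basis_det E f']
    rw [AlternatingMap.smul_apply, Module.Basis.det_comp, Module.Basis.det_self, mul_one, smul_eq_mul,
      mul_comm]
  have h4 : LinearMap.det (g.restrictScalars ℝ) = 1 := by
    rw [LinearMap.det_restrictScalars, Algebra.norm_complex_apply, Complex.normSq_eq_norm_sq, hdet,
      one_pow]
  rw [h2, h3, h4, one_mul]
  exact h1.symm

/-- The real span of `complexFrame u = (u₀, I u₀, …)` is the complex span of `u`, viewed as a
real subspace. [folklore] -/
theorem span_complexFrame (u : Fin p → V) :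
    Submodule.span ℝ (Set.range (complexFrame u)) =
      (Submodule.span ℂ (Set.range u)).restrictScalars ℝ := by
  apply le_antisymm
  · rw [Submodule.span_le]
    rintro _ ⟨k, rfl⟩
    rw [SetLike.mem_coe, Submodule.restrictScalars_mem, complexFrame_apply]
    exact Submodule.smul_mem _ _ (Submodule.subset_span (Set.mem_range_self _))
  · intro x hx
    rw [Submodule.restrictScalars_mem] at hx
    have hI : ∀ y ∈ Submodule.span ℝ (Set.range (complexFrame u)),
        Complex.I • y ∈ Submodule.span ℝ (Set.range (complexFrame u)) := by
      intro y hy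
      induction hy using Submodule.span_induction with
      | mem y hy =>
        obtain ⟨k, rfl⟩ := hy
        rw [complexFrame_apply, smul_smul]
        split_ifs with hk
        · rw [mul_one, ← complexFrame_apply_odd u ⟨(k : ℕ) / 2, by omega⟩]
          exact Submodule.subset_span (Set.mem_range_self _)
        · rw [Complex.I_mul_I, neg_smul, one_smul, ← complexFrame_apply_even u ⟨(k : ℕ) / 2, by omega⟩]
          exact Submodule.neg_mem _ (Submodule.subset_span (Set.mem_range_self _))
      | zero => rw [smul_zero]; exact Submodule.zero_mem _
      | add y z _ _ hy hz => rw [smul_add]; exact Submodule.add_mem _ hy hz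
      | smul a y _ hy => rw [smul_comm]; exact Submodule.smul_mem _ a hy
    induction hx using Submodule.span_induction with
    | mem y hy =>
      obtain ⟨j, rfl⟩ := hy
      rw [← complexFrame_apply_even u j]
      exact Submodule.subset_span (Set.mem_range_self _)
    | zero => exact Submodule.zero_mem _
    | add y z _ _ hy hz => exact Submodule.add_mem _ hy hz
    | smul c y _ hy =>
      have e : c • y = c.re • y + c.im • (Complex.I • y) := by
        conv_lhs => rw [← Complex.re_add_im c]
        rw [add_smul, mul_smul, Complex.coe_smul, Complex.coe_smul]
      rw [e]
      exact Submodule.add_mem _ (Submodule.smul_mem _ _ hy) (Submodule.smul_mem _ _ (hI y hy))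

/-- `frameVector_complexFrame_eq_of_span_eq` with the hypothesis on the real spans of the real
`2p`-frames (the form in which tangent `2p`-planes are compared in
`HolomorphicChain.orientationFrame`). [folklore] -/
theorem frameVector_complexFrame_eq_of_span_complexFrame_eq {u u' : Fin p → V}
    (hu : Orthonormal ℂ u) (hu' : Orthonormal ℂ u')
    (h : Submodule.span ℝ (Set.range (complexFrame u')) =
      Submodule.span ℝ (Set.range (complexFrame u))) :
    frameVector (complexFrame u') = frameVector (complexFrame u) :=
  frameVector_complexFrame_eq_of_span_eq hu hu'
    (Submodule.restrictScalars_injective ℝ ℂ V (by rwa [← span_complexFrame, ← span_complexFrame]))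

variable [MeasurableSpace V] [BorelSpace V] {Ω : TopologicalSpace.Opens V}

/-- **The orientation `2p`-vector of `[T]` is canonical**: at a point `x` where SOME unitary
`p`-frame `u` has real span `Tan^{2p}(𝓗^{2p} ⌞ reg |T|, x)`, the frame chosen by
`HolomorphicChain.orientationFrame` defines the same simple `2p`-vector as `complexFrame u`; so in
`[T](φ) = ∫ θ_T φ(ξ_T) d𝓗^{2p}` any (e.g. measurable, or chart-given) field of unitary tangent
frames may be used in place of `ξ_T`. [cite: Chirka1989, §14.1, p. 174] -/
theorem HolomorphicChain.frameVector_orientationFrame (T : HolomorphicChain 𝓘(ℂ, V) Ω p) {x : V}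
    {u : Fin p → V} (hu : Orthonormal ℂ u)
    (h : (Submodule.span ℝ (Set.range (complexFrame u)) : Set V) =
      approxTangentCone (2 * p) ((μHE[2 * p] : Measure V).restrict T.carrier) x) :
    frameVector (T.orientationFrame x) = frameVector (complexFrame u) := by
  classical
  have hex : ∃ u : Fin p → V, Orthonormal ℂ u ∧
      ((Submodule.span ℝ (Set.range (complexFrame u)) : Set V) =
        approxTangentCone (2 * p) ((μHE[2 * p] : Measure V).restrict T.carrier) x) := ⟨u, hu, h⟩
  simp only [HolomorphicChain.orientationFrame, dif_pos hex]
  exact frameVector_complexFrame_eq_of_span_complexFrame_eq hu hex.choose_spec.1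
    (SetLike.coe_injective (hex.choose_spec.2.trans h.symm))

/-- Where the approximate tangent cone of `𝓗^{2p} ⌞ reg |T|` is not the real span of a unitary
`p`-frame (an `𝓗^{2p} ⌞ reg |T|`-null set), the orientation frame is `0`.
[cite: Chirka1989, §14.1, p. 174] -/
theorem HolomorphicChain.orientationFrame_eq_zero (T : HolomorphicChain 𝓘(ℂ, V) Ω p) {x : V}
    (h : ¬ ∃ u : Fin p → V, Orthonormal ℂ u ∧
      ((Submodule.span ℝ (Set.range (complexFrame u)) : Set V) =
        approxTangentCone (2 * p) ((μHE[2 * p] : Measure V).restrict T.carrier) x)) :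
    T.orientationFrame x = 0 := by
  classical
  simp only [HolomorphicChain.orientationFrame, dif_neg h]

end Orientation

/-! ### Blow-ups off the support; King's theorem there -/

section BlowUp

variable {V : Type*} [NormedAddCommGroup V] [InnerProductSpace ℂ V] [MeasurableSpace V]
  [BorelSpace V] {Ω : TopologicalSpace.Opens V} {p : ℕ}

/-- **Off the support the blow-up is zero.** If `r > 0` and the ball `B(b, r)` does not meet the
support `|T|` (viewed in `V`), then `(1/r)_*(τ_{-b})_*[T] = 0` on `B(0,1)`: the carrier
`{y : b + r y ∈ reg |T|} ∩ B(0,1)` of the blown-up current of integration is empty.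
[cite: Harvey1977, §1.10] -/
theorem HolomorphicChain.blowUp_eq_zero_of_disjoint (T : HolomorphicChain 𝓘(ℂ, V) Ω p) {b : V}
    {r : ℝ} (hr : 0 < r) (h : Disjoint (Metric.ball b r) ((↑) '' T.support : Set V)) :
    T.blowUp b r = 0 := by
  have hempty : (fun y => b + r • y) ⁻¹' T.carrier ∩ Metric.ball (0 : V) 1 = ∅ := by
    refine Set.eq_empty_iff_forall_notMem.2 fun y hy => ?_
    obtain ⟨hy1, hy2⟩ := hy
    have hmem : b + r • y ∈ Metric.ball b r := by
      rw [Metric.mem_ball, dist_eq_norm, add_sub_cancel_left, norm_smul, Real.norm_eq_abs,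
        abs_of_pos hr]
      have hy' : ‖y‖ < 1 := mem_ball_zero_iff.1 hy2
      calc r * ‖y‖ < r * 1 := mul_lt_mul_of_pos_left hy' hr
        _ = r := mul_one r
    exact (Set.disjoint_left.1 h) hmem (T.carrier_subset_image_support hy1)
  rw [HolomorphicChain.blowUp, hempty, currentOfIntegration_empty]

omit [MeasurableSpace V] [BorelSpace V] in
/-- A point of `Ω` off the support of a chain has a ball around it missing the support (the
support is closed in `Ω`, `HolomorphicChain.isClosed_support`, and `Ω` is open). [folklore] -/
theorem HolomorphicChain.exists_ball_disjoint_support [FiniteDimensional ℂ V]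
    (T : HolomorphicChain 𝓘(ℂ, V) Ω p) {b : V} (hb : b ∈ Ω)
    (hbT : b ∉ ((↑) '' T.support : Set V)) :
    ∃ r₀ : ℝ, 0 < r₀ ∧ Disjoint (Metric.ball b r₀) ((↑) '' T.support : Set V) := by
  haveI : LocallyCompactSpace Ω := Ω.isOpen.locallyCompactSpace
  have hclosed : IsClosed T.support := T.isClosed_support
  have hb' : (⟨b, hb⟩ : Ω) ∉ T.support := fun h => hbT ⟨⟨b, hb⟩, h, rfl⟩
  have hnhds : T.supportᶜ ∈ 𝓝 (⟨b, hb⟩ : Ω) := hclosed.isOpen_compl.mem_nhds hb'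
  rw [nhds_subtype, Filter.mem_comap] at hnhds
  obtain ⟨U, hU, hUT⟩ := hnhds
  obtain ⟨r₀, hr₀, hball⟩ := Metric.mem_nhds_iff.1 hU
  refine ⟨r₀, hr₀, Set.disjoint_left.2 ?_⟩
  rintro _ hy ⟨x, hx, rfl⟩
  exact hUT (show x ∈ (↑) ⁻¹' U from hball hy) hx

/-- Off the support, the blow-ups `(1/r)_*(τ_{-b})_*[T]` vanish for all sufficiently small `r > 0`.
[cite: Harvey1977, §1.10] -/
theorem HolomorphicChain.eventually_blowUp_eq_zero [FiniteDimensional ℂ V]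
    (T : HolomorphicChain 𝓘(ℂ, V) Ω p) {b : V} (hb : b ∈ Ω)
    (hbT : b ∉ ((↑) '' T.support : Set V)) :
    ∀ᶠ r in 𝓝[>] (0 : ℝ), T.blowUp b r = 0 := by
  obtain ⟨r₀, hr₀, hdisj⟩ := T.exists_ball_disjoint_support hb hbT
  have hIoo : Set.Ioo (0 : ℝ) r₀ ∈ 𝓝[>] (0 : ℝ) := Ioo_mem_nhdsGT hr₀
  filter_upwards [hIoo] with r hr
  exact T.blowUp_eq_zero_of_disjoint hr.1
    (hdisj.mono_left (Metric.ball_subset_ball hr.2.le))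

end BlowUp

/-- **King's theorem off the support.** For a holomorphic `p`-chain `T` on `Ω ⊆ V` and a base point
`b ∈ Ω ∖ |T|`, the tangent cone is `C(T, b) = 0`: for all small `r > 0` the blow-up
`(1/r)_*(τ_{-b})_*[T]` is the zero current on `B(0,1)`, so it lies in every basic neighbourhood
`{spt(· − R − ∂S) ∩ W = ∅, 𝐌(R) + 𝐌(S) < δ}` of `0` in `𝓕^{loc}_{2p}(B(0,1))` (with `R = S = 0`),
and the support of the zero chain is (vacuously) a homogeneous variety. This is the conclusion of
`King1971_tangentCone` at such `b`. [cite: Harvey1977, Thm. 1.31] -/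
theorem King1971_tangentCone_of_notMem_support (V : Type u) [NormedAddCommGroup V]
    [InnerProductSpace ℂ V] [FiniteDimensional ℂ V] [MeasurableSpace V] [BorelSpace V]
    (Ω : TopologicalSpace.Opens V) (p : ℕ) (T : HolomorphicChain 𝓘(ℂ, V) Ω p) (b : V)
    (hb : b ∈ Ω) (hbT : b ∉ ((↑) '' T.support : Set V)) :
    letI : InnerProductSpace ℝ V := InnerProductSpace.complexToReal
    ∃ C : HolomorphicChain 𝓘(ℂ, V) (⊤ : TopologicalSpace.Opens V) p,
      (∀ x ∈ C.support, ∀ c : ℂ,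
        (⟨c • (x : V), trivial⟩ : (⊤ : TopologicalSpace.Opens V)) ∈ C.support) ∧
      ∀ (W : Set V), IsOpen W → IsCompact (closure W) → closure W ⊆ Metric.ball (0 : V) 1 →
        ∀ δ : ℝ≥0∞, 0 < δ → ∀ᶠ r in 𝓝[>] (0 : ℝ),
          ∃ (R : Current (unitBall V) (2 * p)) (S : Current (unitBall V) (2 * p + 1)),
            R.IsRectifiable ∧ S.IsRectifiable ∧
            (T.blowUp b r - C.toCurrentIn (unitBall V) - R - S.boundary).support ∩ W = ∅ ∧
            R.mass + S.mass < δ := by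
  letI : InnerProductSpace ℝ V := InnerProductSpace.complexToReal
  refine ⟨0, fun x hx => ?_, fun W _ _ _ δ hδ => ?_⟩
  · simp at hx
  · filter_upwards [T.eventually_blowUp_eq_zero hb hbT] with r hr
    refine ⟨0, 0, Current.isRectifiable_zero, Current.isRectifiable_zero, ?_, ?_⟩
    · rw [hr, HolomorphicChain.toCurrentIn_zero, Current.boundary_zero, sub_zero, sub_zero,
        sub_zero, Current.support_zero, Set.empty_inter]
    · simpa using hδ

/-- **King's theorem in dimensions `p > dim V`.** There every holomorphic `p`-chain is `0`
(`HolomorphicChain.mult_eq_zero_of_finrank_lt`), its support is empty, and the conclusion of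
`King1971_tangentCone` holds at every `b ∈ Ω` with `C(T, b) = 0`. [cite: Harvey1977, Thm. 1.31] -/
theorem King1971_tangentCone_of_finrank_lt (V : Type u) [NormedAddCommGroup V]
    [InnerProductSpace ℂ V] [FiniteDimensional ℂ V] [MeasurableSpace V] [BorelSpace V]
    (Ω : TopologicalSpace.Opens V) (p : ℕ) (hp : Module.finrank ℂ V < p)
    (T : HolomorphicChain 𝓘(ℂ, V) Ω p) (b : V) (hb : b ∈ Ω) :
    letI : InnerProductSpace ℝ V := InnerProductSpace.complexToReal
    ∃ C : HolomorphicChain 𝓘(ℂ, V) (⊤ : TopologicalSpace.Opens V) p,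
      (∀ x ∈ C.support, ∀ c : ℂ,
        (⟨c • (x : V), trivial⟩ : (⊤ : TopologicalSpace.Opens V)) ∈ C.support) ∧
      ∀ (W : Set V), IsOpen W → IsCompact (closure W) → closure W ⊆ Metric.ball (0 : V) 1 →
        ∀ δ : ℝ≥0∞, 0 < δ → ∀ᶠ r in 𝓝[>] (0 : ℝ),
          ∃ (R : Current (unitBall V) (2 * p)) (S : Current (unitBall V) (2 * p + 1)),
            R.IsRectifiable ∧ S.IsRectifiable ∧
            (T.blowUp b r - C.toCurrentIn (unitBall V) - R - S.boundary).support ∩ W = ∅ ∧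
            R.mass + S.mass < δ := by
  have hT : T = 0 := HolomorphicChain.mult_injective (funext fun Z => T.mult_eq_zero_of_finrank_lt hp Z)
  refine King1971_tangentCone_of_notMem_support V Ω p T b hb ?_
  rw [hT, HolomorphicChain.support_zero, Set.image_empty]
  exact Set.notMem_empty b

end Literature.Geometry.Kaehler
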